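import Summits.QuantumFields.BalabanUV.Beta.GAN24.DerivativeRateTransferJensenChain

/-!
# `BalabanUV.Beta.GAN24.DerivativeRateTransferJensenHolonomy` — binder row G-an2-4 ∕ (CONV-C), route R6 «VALUES, NOT DERIVATIVES», PART 25:
# THE HOLONOMY-DEFECT LETTERS (the «lasso ∕ lattice-Stokes SHAPE» feeding PART 22's κ) — the defect `|(V − 1)w| ≤ κ|w|` is invariant under orthogonal
# conjugation and transposition, SUBADDITIVE under products of orthogonal matrices, hence a loop holonomy written as a product of `n` conjugated
# plaquette holonomies each within `κ_p` of `1` is within `n·κ_p` of `1` (unit b2b-balaban-gan24-p3, gen 37; v1)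

NOT IN PRINT; OUR PROOF (for the ROUTE; [folklore] — `(AB − 1) = A(B − 1) + (A − 1)`, orthogonal invariance of `|·|`, Cauchy–Schwarz; the shape was
offered by gan24-idea-1 g38 (journal [IDEA1-G38-ONLINE] (3)): «for unitaries `‖AB − 1‖ ≤ ‖A − 1‖ + ‖B − 1‖` and conjugation-invariance ⟹
`‖Hol(∂Σ) − 1‖ ≤ Σ_{p∈Σ} ‖U(∂p) − 1‖` for any loop written as a product of lassos»).  HONEST FRAMING (cell contract, verbatim): «discharging `BetaPertH`
makes Bałaban's UV stability UNCONDITIONAL — a real constructive-QFT result; it is NOT the continuum limit and NOT the Clay problem.»  HONEST DEPENDENCY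
(verbatim): «continuum YM on T⁴ ⇐ BetaPertH ∧ nine spine estimates (0/9 proved); BetaPertH ⇐ (D1) ∧ (D4) ∧ CAP+tail; G-an2-4 gates asym, D1 and NE2/3/4.»

WHY THIS FILE.  PART 22 (`DerivativeRateTransferJensen.covJensen_holonomy`) takes the loop-holonomy defect `κ` as a HYPOTHESIS
(`|(V − 1)w|² ≤ κ²|w|²` for the loops «block contour → coarse bond → block contour back → fine chain back»); PART 20's pricing handle `δ` is «TO BE PROVED
from a small-field bound on the fine plaquette variables by a lattice-Stokes telescoping» (A1 [GAN24P3-G37-A1]).  THIS FILE is the algebra of that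
telescoping in PART 21's currency (`Matrix o o ℝ`, `RᵀR = 1`, `⬝ᵥ`): whoever exhibits the block loop as a product of `n` lassos `P_i·U(∂p_i)·P_iᵀ`
(orthogonal path transports `P_i`, plaquette holonomies within `κ_p` of `1`) gets `κ = n·κ_p` — for a level-`j` block loop `n = O(L²)` plaquettes of the
level-`(j+1)` lattice, so `κ_j = O(L²·κ_p^{(j+1)})`, geometric in `j` when the plaquette defect is `O(η_{j+1}²)` (continuum background) — the `K ≤ cK·τ²`
input of PART 23 §1.  The geometric decomposition into lassos is NOT done here (lattice geometry; ON REQUEST).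

WHAT THIS FILE PROVES (0 sorry, 0 `def`, nothing cited):
* §1 `sq_dotProduct_le_mul` (Cauchy–Schwarz `(a⬝b)² ≤ (a⬝a)(b⬝b)`), **`dotProduct_self_add_le_sq`** (`|a|² ≤ α²m`, `|b|² ≤ β²m` ⟹ `|a + b|² ≤ (α+β)²m`).
* §2 the defect letters: `defect_one` (`κ = 0` for `V = 1`), **`defect_conj`** (`RVRᵀ`, `R` orthogonal: same κ), `defect_transpose` (`Vᵀ`, `V` orthogonal:
  same κ), **`defect_mul`** (`A` orthogonal: `κ_{AB} ≤ κ_A + κ_B`), `defect_mono` (κ ≤ κ′), **`defect_listProd`** (a list of orthogonal factors each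
  within `κ` ⟹ the product within `length·κ`), `orthogonal_listProd`.
* §3 **`defect_of_lassos`** — `V = Π_i P_i U_i P_iᵀ` with `P_i`, `U_i` orthogonal and `|(U_i − 1)w|² ≤ κ_p²|w|²` ⟹ `|(V − 1)w|² ≤ (n·κ_p)²|w|²`.
WHAT IT DOES NOT DO: write Bałaban's block loop as a product of lassos (geometry), or bound `κ_p` (the small-field condition is the consumer's).  SUPPLIER
work on route R6 (rank 2, REDUCTION, no seat); no consumer of record; NEVER «G-an2-4 closed»; NOT (CONV-C), NOT D1, NOT `BetaPertH`, NOT continuum, NOT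
Clay.  Records: `HOME/b2b-balaban-gan24-p3/WOODBURY-FIBRE.md` v13.7.
-/

noncomputable section

open Matrix

namespace Summit.QuantumFields.BalabanUV.Beta.GAN24.DerivativeRateTransferJensenHolonomy

open Summit.QuantumFields.BalabanUV.Beta.GAN24.DerivativeRateTransferJensenChain

variable {o : Type*} [Fintype o] [DecidableEq o]

/-! ## §1 A square-root-free triangle inequality -/

section Triangle

omit [DecidableEq o] in
/-- **CAUCHY–SCHWARZ**: `(a⬝b)² ≤ (a⬝a)·(b⬝b)`. [folklore] -/
theorem sq_dotProduct_le_mul (a b : o → ℝ) : (a ⬝ᵥ b) ^ 2 ≤ (a ⬝ᵥ a) * (b ⬝ᵥ b) := by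
  have h := Finset.sum_mul_sq_le_sq_mul_sq Finset.univ a b
  simp only [dotProduct, sq] at h ⊢
  exact h

omit [DecidableEq o] in
/-- **THE SQUARE-ROOT-FREE TRIANGLE INEQUALITY**: `|a|² ≤ α²·m`, `|b|² ≤ β²·m` with `α, β, m ≥ 0` ⟹ `|a + b|² ≤ (α + β)²·m`
(`|a+b|² = |a|² + 2a⬝b + |b|²` and `a⬝b ≤ αβ·m` by Cauchy–Schwarz). [folklore] -/
theorem dotProduct_self_add_le_sq (a b : o → ℝ) {α β m : ℝ} (hα : 0 ≤ α) (hβ : 0 ≤ β) (hm : 0 ≤ m)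
    (ha : a ⬝ᵥ a ≤ α ^ 2 * m) (hb : b ⬝ᵥ b ≤ β ^ 2 * m) : (a + b) ⬝ᵥ (a + b) ≤ (α + β) ^ 2 * m := by
  have haa := dotProduct_self_nonneg' a
  have hbb := dotProduct_self_nonneg' b
  have hcs := sq_dotProduct_le_mul a b
  have hab : a ⬝ᵥ b ≤ α * β * m := by
    have h1 : (a ⬝ᵥ b) ^ 2 ≤ (α * β * m) ^ 2 := by
      calc (a ⬝ᵥ b) ^ 2 ≤ (a ⬝ᵥ a) * (b ⬝ᵥ b) := hcs
        _ ≤ (α ^ 2 * m) * (β ^ 2 * m) := mul_le_mul ha hb hbb (haa.trans ha)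
        _ = (α * β * m) ^ 2 := by ring
    exact (abs_le_of_sq_le_sq' h1 (by positivity)).2
  have e : (a + b) ⬝ᵥ (a + b) = a ⬝ᵥ a + 2 * (a ⬝ᵥ b) + b ⬝ᵥ b := by
    simp only [add_dotProduct, dotProduct_add, dotProduct_comm b a]; ring
  rw [e]; nlinarith

end Triangle

/-! ## §2 The defect letters -/

section Defect

/-- `V = 1` has defect `0`. [folklore] -/
theorem defect_one (w : o → ℝ) : (((1 : Matrix o o ℝ) - 1) *ᵥ w) ⬝ᵥ (((1 : Matrix o o ℝ) - 1) *ᵥ w) ≤ (0 : ℝ) ^ 2 * (w ⬝ᵥ w) := by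
  simp

/-- monotonicity in κ. [folklore] -/
theorem defect_mono {V : Matrix o o ℝ} {κ κ' : ℝ} (hκ : 0 ≤ κ) (hle : κ ≤ κ')
    (hV : ∀ w : o → ℝ, ((V - 1) *ᵥ w) ⬝ᵥ ((V - 1) *ᵥ w) ≤ κ ^ 2 * (w ⬝ᵥ w)) :
    ∀ w : o → ℝ, ((V - 1) *ᵥ w) ⬝ᵥ ((V - 1) *ᵥ w) ≤ κ' ^ 2 * (w ⬝ᵥ w) := fun w =>
  (hV w).trans (mul_le_mul_of_nonneg_right (pow_le_pow_left₀ hκ hle 2) (dotProduct_self_nonneg' w))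

/-- **CONJUGATION INVARIANCE**: `R` orthogonal, `V` within κ ⟹ `RVRᵀ` within κ (`RVRᵀ − 1 = R(V − 1)Rᵀ`). [folklore] -/
theorem defect_conj {V R : Matrix o o ℝ} {κ : ℝ} (hR : Rᵀ * R = 1)
    (hV : ∀ w : o → ℝ, ((V - 1) *ᵥ w) ⬝ᵥ ((V - 1) *ᵥ w) ≤ κ ^ 2 * (w ⬝ᵥ w)) :
    ∀ w : o → ℝ, ((R * V * Rᵀ - 1) *ᵥ w) ⬝ᵥ ((R * V * Rᵀ - 1) *ᵥ w) ≤ κ ^ 2 * (w ⬝ᵥ w) := fun w => by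
  have e : (R * V * Rᵀ - 1) *ᵥ w = R *ᵥ ((V - 1) *ᵥ (Rᵀ *ᵥ w)) := by
    rw [mulVec_mulVec, mulVec_mulVec, Matrix.mul_sub, Matrix.sub_mul, Matrix.mul_one, mul_transpose_of_orthogonal hR]
  rw [e, self_of_orthogonal hR, ← self_of_orthogonal (transpose_orthogonal hR) w]
  exact hV _

/-- **TRANSPOSITION INVARIANCE**: `V` orthogonal within κ ⟹ `Vᵀ` within κ (`Vᵀ − 1 = −Vᵀ(V − 1)`). [folklore] -/
theorem defect_transpose {V : Matrix o o ℝ} {κ : ℝ} (hVo : Vᵀ * V = 1)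
    (hV : ∀ w : o → ℝ, ((V - 1) *ᵥ w) ⬝ᵥ ((V - 1) *ᵥ w) ≤ κ ^ 2 * (w ⬝ᵥ w)) :
    ∀ w : o → ℝ, ((Vᵀ - 1) *ᵥ w) ⬝ᵥ ((Vᵀ - 1) *ᵥ w) ≤ κ ^ 2 * (w ⬝ᵥ w) := fun w => by
  have e : (Vᵀ - 1) *ᵥ w = -(Vᵀ *ᵥ ((V - 1) *ᵥ w)) := by
    rw [mulVec_mulVec, Matrix.mul_sub, hVo, Matrix.mul_one, ← neg_mulVec, neg_sub]
  rw [e, neg_dotProduct, dotProduct_neg, neg_neg, self_of_orthogonal (transpose_orthogonal hVo)]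
  exact hV w

/-- **SUBADDITIVITY UNDER PRODUCTS**: `A` orthogonal within `κ_A`, `B` within `κ_B` (`κ_A, κ_B ≥ 0`) ⟹ `AB` within `κ_A + κ_B`
(`(AB − 1)w = A(B − 1)w + (A − 1)w`, `|A z| = |z|`, square-root-free triangle inequality). [folklore] -/
theorem defect_mul {A B : Matrix o o ℝ} {κA κB : ℝ} (hAo : Aᵀ * A = 1) (hκA : 0 ≤ κA) (hκB : 0 ≤ κB)
    (hA : ∀ w : o → ℝ, ((A - 1) *ᵥ w) ⬝ᵥ ((A - 1) *ᵥ w) ≤ κA ^ 2 * (w ⬝ᵥ w))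
    (hB : ∀ w : o → ℝ, ((B - 1) *ᵥ w) ⬝ᵥ ((B - 1) *ᵥ w) ≤ κB ^ 2 * (w ⬝ᵥ w)) :
    ∀ w : o → ℝ, ((A * B - 1) *ᵥ w) ⬝ᵥ ((A * B - 1) *ᵥ w) ≤ (κA + κB) ^ 2 * (w ⬝ᵥ w) := fun w => by
  have e : (A * B - 1) *ᵥ w = A *ᵥ ((B - 1) *ᵥ w) + (A - 1) *ᵥ w := by
    rw [mulVec_mulVec, Matrix.mul_sub, Matrix.mul_one, sub_mulVec, sub_mulVec, sub_mulVec, one_mulVec]; abel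
  rw [e, add_comm (κA) κB]
  refine dotProduct_self_add_le_sq _ _ hκB hκA (dotProduct_self_nonneg' w) ?_ (hA w)
  rw [self_of_orthogonal hAo]; exact hB w

/-- products of orthogonal matrices (list form). [folklore] -/
theorem orthogonal_listProd (l : List (Matrix o o ℝ)) (h : ∀ X ∈ l, Xᵀ * X = 1) : (l.prod)ᵀ * l.prod = 1 := by
  induction l with
  | nil => simp
  | cons X t ih =>
    rw [List.prod_cons]
    exact orthogonal_mul (h X (by simp)) (ih fun Y hY => h Y (by simp [hY]))

/-- **`defect_listProd` — THE TELESCOPING**: a list of orthogonal factors each within `κ ≥ 0` of `1` has product within `length·κ` of `1`. [folklore] -/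
theorem defect_listProd (l : List (Matrix o o ℝ)) {κ : ℝ} (hκ : 0 ≤ κ) (ho : ∀ X ∈ l, Xᵀ * X = 1)
    (hd : ∀ X ∈ l, ∀ w : o → ℝ, ((X - 1) *ᵥ w) ⬝ᵥ ((X - 1) *ᵥ w) ≤ κ ^ 2 * (w ⬝ᵥ w)) :
    ∀ w : o → ℝ, ((l.prod - 1) *ᵥ w) ⬝ᵥ ((l.prod - 1) *ᵥ w) ≤ (l.length * κ) ^ 2 * (w ⬝ᵥ w) := by
  induction l with
  | nil => intro w; simp
  | cons X t ih =>
    intro w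
    rw [List.prod_cons, List.length_cons]
    have hX := ho X (by simp)
    have ht : ∀ Y ∈ t, Yᵀ * Y = 1 := fun Y hY => ho Y (by simp [hY])
    have hdt : ∀ Y ∈ t, ∀ w : o → ℝ, ((Y - 1) *ᵥ w) ⬝ᵥ ((Y - 1) *ᵥ w) ≤ κ ^ 2 * (w ⬝ᵥ w) := fun Y hY => hd Y (by simp [hY])
    have h := defect_mul hX hκ (mul_nonneg (Nat.cast_nonneg _) hκ) (hd X (by simp)) (ih ht hdt) w
    refine h.trans (le_of_eq ?_)
    push_cast; ring

end Defect

/-! ## §3 Lassos: a loop holonomy as a product of conjugated plaquette holonomies -/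

section Lassos

/-- **`defect_of_lassos` — THE LATTICE-STOKES SHAPE FOR κ** [our proof]: if the loop holonomy is a product of `n` lassos `P_i·U_i·P_iᵀ` with orthogonal
path transports `P_i` and orthogonal plaquette holonomies `U_i` each within `κ_p ≥ 0` of `1`, then it is within `n·κ_p` of `1`:
`|(Π_i P_iU_iP_iᵀ − 1)w|² ≤ (n·κ_p)²·|w|²`.  (For PART 22: a level-`j` block loop spans `n = O(L²)` plaquettes of the finer lattice.) -/
theorem defect_of_lassos {n : ℕ} (P U : Fin n → Matrix o o ℝ) {κp : ℝ} (hκp : 0 ≤ κp)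
    (hP : ∀ i, (P i)ᵀ * P i = 1) (hU : ∀ i, (U i)ᵀ * U i = 1)
    (hd : ∀ i (w : o → ℝ), ((U i - 1) *ᵥ w) ⬝ᵥ ((U i - 1) *ᵥ w) ≤ κp ^ 2 * (w ⬝ᵥ w)) :
    ∀ w : o → ℝ, (((List.ofFn fun i => P i * U i * (P i)ᵀ).prod - 1) *ᵥ w) ⬝ᵥ
        (((List.ofFn fun i => P i * U i * (P i)ᵀ).prod - 1) *ᵥ w) ≤ (n * κp) ^ 2 * (w ⬝ᵥ w) := by
  have h := defect_listProd (List.ofFn fun i => P i * U i * (P i)ᵀ) hκp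
    (fun X hX => by
      obtain ⟨i, rfl⟩ := List.mem_ofFn.mp hX
      exact orthogonal_mul (orthogonal_mul (hP i) (hU i)) (transpose_orthogonal (hP i)))
    (fun X hX => by
      obtain ⟨i, rfl⟩ := List.mem_ofFn.mp hX
      exact defect_conj (hP i) (hd i))
  simpa only [List.length_ofFn] using h

end Lassos

end Summit.QuantumFields.BalabanUV.Beta.GAN24.DerivativeRateTransferJensenHolonomy

end
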